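import Literature.MathematicalPhysics.QuantumFieldTheory.Balaban1983to89.B14Eq213DetSet
import Literature.MathematicalPhysics.QuantumFieldTheory.Balaban1983to89.B10Eq27TorusAxialLog
import Literature.MathematicalPhysics.QuantumFieldTheory.Balaban1983to89.B4Eq19LatticeOperators
import HarnessLib

/-!
# Line «sandwich_discharge» on crux `HistoryTailL` (stmt-QuantumFields-19936), stub `stub_sandwichSweepGapCapped` (S′), B6 door items (α)(ε) —
# «THE DOOR'S SITES»: the coarse plaquette `P″` above `p` with the profile socket's nesting identity, the comb centre `c₀ = embIter j p.src`
# at which the restricted axial gauge transformation is `1`, and the re-centring of the profile's support box from the corner `C` to `c₀`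

Cell `ym3-torus` (YM ladder rung R3 = continuum SU(2) Yang–Mills on the three-torus — a RUNG, NOT the Clay problem); width seat `ym3-torus-px8` gen 7;
`--supports stmt-QuantumFields-19936` (helper).  THEOREMS ONLY (0 `def`, default heartbeats), literature-only imports.

WHY (px8 g7 memo «B6 DOOR v3» D1∕D3∕D6 (d), items (α)(ε)).  (α) The profile socket ✍`CovariantDischargeProfileSocket.exists_profile_socket` is invoked at
`y := p.src : Site _ j` and `Y := P″.src : Site _ h` under the nesting hypothesis `∀ i, (y i).val ∕ L^(h−j) = (Y i).val`; §1 constructs `P″` (same directions as `p`,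
source `blockIter h (embIter j p.src)`) and proves that identity from lit ✓`val_blockIter` ∕ ✓`val_embIter_div` (standing range `h ≤ m + K`).  (ε) The action rows
read the signal in the comb gauge `W̃ = V^{axialT V c₀}`; by ✓`plaqHol_iter_eq_conj_of_eqOn_feeds` ∕ `iter_gaugeAct` the averaged plaquette of `W̃` at `p` is that of `V`
conjugated by `transfUp (axialT V c₀) j p.src`; §2 shows this is `1` when `c₀ := embIter j p.src` (both recursions `transfUp`∕`embIter` run along the block centres, and
✓`axialT_self`), so the stub's window hypothesis is read EXACTLY.  §3 pins `c₀` between the socket's corner `C` (`val(C i) = val(Y i)·L^h`) and `C + L^h`, and §4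
re-centres the profile's support `transl C '' box 0 R` at `c₀` with radius `R + L^h` — the `hS` hypothesis shape of the comb sweep pair (w5 FILE C) and of its action rows.
* §1 `val_embIter_div_pow`, ★`exists_coarsePlaq`;  §2 ★`transfUp_axialT_embIter`;  §3 `val_embIter_bounds`, `corner_le_centre_lt`;  §4 `transl_eq_transl_recentre`, ★`exists_recentred`.
HONEST SCOPE: site bookkeeping; nothing of B6∕S′∕`stub_sandwichSweepGapCapped`∕`HistoryTailL` proved or claimed; YM₃ on T³ is rung R3, not d = 4, not Clay.
[cite: Balaban1987RG1, (0.1) p.251; Balaban1985Averaging, (11) p.19 and p.24]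
-/

noncomputable section

namespace Summit.QuantumFields.YangMills.Theorems.CovariantDischargeDoorSites

open Literature.MathematicalPhysics.QuantumFieldTheory.Balaban1983to89
open Literature.MathematicalPhysics.QuantumFieldTheory.Balaban1983to89.T4Continuum (transfUp)
open Literature.MathematicalPhysics.QuantumFieldTheory.Balaban1983to89.B15DeterminingSets (embIter)
open Literature.MathematicalPhysics.QuantumFieldTheory.Balaban1983to89.B14.Eq22Determines (blockIter)
open Literature.MathematicalPhysics.QuantumFieldTheory.Balaban1983to89.B14.Eq213DetSet (val_blockIter val_embIter_div)
open Literature.MathematicalPhysics.QuantumFieldTheory.Balaban1983to89.B10Eq27TorusAxialLog (transl axialT axialT_self)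
open Literature.MathematicalPhysics.QuantumFieldTheory.Balaban1983to89.B4Eq19LatticeOperators (Zd box mem_box)

variable {P : Params}

/-! ## §1 The coarse plaquette above `p` and the nesting identity -/

/-- `⌊val(embIter j y)_ν ∕ L^h⌋ = ⌊val(y)_ν ∕ L^{h−j}⌋` for `j ≤ h ≤ m + K` (the centre embedding keeps the `L^j`-label; divide further by `L^{h−j}`).
[cite: Balaban1987RG1, (0.1) p.251] -/
theorem val_embIter_div_pow {j h : ℕ} (hjh : j ≤ h) (hh : h ≤ P.m + P.K) (y : Site P j) (ν : Fin P.d) :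
    ((embIter j y) ν).val / P.L ^ h = (y ν).val / P.L ^ (h - j) := by
  have hj : j ≤ P.m + P.K := hjh.trans hh
  have e : P.L ^ h = P.L ^ j * P.L ^ (h - j) := by rw [← pow_add, Nat.add_sub_cancel' hjh]
  rw [e, ← Nat.div_div_eq_div_mul, val_embIter_div hj]

/-- ★ **THE COARSE PLAQUETTE ABOVE `p`**: for `j ≤ h ≤ m + K` and `p : Plaq P j` there is `P″ : Plaq P h` with the same directions, source
`blockIter h (embIter j p.src)`, and the nesting identity `∀ i, val(p.src i) ∕ L^{h−j} = val(P″.src i)` (the profile socket's hypothesis shape).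
[cite: Balaban1987RG1, (0.1) p.251] -/
theorem exists_coarsePlaq {j h : ℕ} (hjh : j ≤ h) (hh : h ≤ P.m + P.K) (p : Plaq P j) :
    ∃ q : Plaq P h, q.μ = p.μ ∧ q.ν = p.ν ∧ q.src = blockIter h (embIter j p.src) ∧
      ∀ i, (p.src i).val / P.L ^ (h - j) = (q.src i).val := by
  refine ⟨⟨blockIter h (embIter j p.src), p.μ, p.ν, p.hμν⟩, rfl, rfl, rfl, fun i => ?_⟩
  show (p.src i).val / P.L ^ (h - j) = ((blockIter h (embIter j p.src)) i).val
  rw [val_blockIter hh, val_embIter_div_pow hjh hh]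

/-! ## §2 The restricted axial gauge transformation is `1` at the centre's own coarse site -/

/-- ★ **`(axialT V c₀)^{(j)}(p.src) = 1` for `c₀ = embIter j p.src`**: `transfUp u j y = u (embIter j y)` (both recursions run along the block centres `emb`) and
the axial gauge transformation is `1` at its centre (✓`axialT_self`). [cite: Balaban1985Averaging, (11) p.19 and p.24] -/
theorem transfUp_axialT_embIter {G : Type*} [GaugeGroup G] (V : GaugeField P 0 G) (j : ℕ) (y : Site P j) :
    transfUp (axialT V (embIter j y)) j y = 1 := by
  have key : ∀ (u : GaugeTransf P 0 G) (k : ℕ) (x : Site P k), transfUp u k x = u (embIter k x) := by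
    intro u k
    induction k with
    | zero => intro x; rfl
    | succ n ih => intro x; exact ih (emb x)
  rw [key]
  exact axialT_self V (embIter j y)

/-! ## §3 The centre embedding against the corner -/

/-- `val(y)_ν·L^j ≤ val(embIter j y)_ν < (val(y)_ν + 1)·L^j` (standing range). [cite: Balaban1987RG1, (0.1) p.251] -/
theorem val_embIter_bounds {j : ℕ} (hj : j ≤ P.m + P.K) (y : Site P j) (ν : Fin P.d) :
    (y ν).val * P.L ^ j ≤ ((embIter j y) ν).val ∧ ((embIter j y) ν).val < ((y ν).val + 1) * P.L ^ j := by
  have hL : 0 < P.L ^ j := pow_pos P.L_pos j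
  have h := val_embIter_div hj y ν
  constructor
  · rw [← h]; exact Nat.div_mul_le_self _ _
  · rw [← h, Nat.add_mul, one_mul]; exact Nat.lt_div_mul_add hL

/-- **CORNER ≤ CENTRE < CORNER + L^h**: with `val(C i) = val(Y i)·L^h` (the profile socket's corner) and the nesting `val(y i) ∕ L^{h−j} = val(Y i)`,
the comb centre `c₀ = embIter j y` satisfies `val(C ν) ≤ val(c₀ ν) < val(C ν) + L^h`. [cite: Balaban1987RG1, (0.1) p.251] -/
theorem corner_le_centre_lt {j h : ℕ} (hjh : j ≤ h) (hh : h ≤ P.m + P.K) (y : Site P j) (Y : Site P h) (C : Site P 0)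
    (hC : ∀ i, (C i).val = (Y i).val * P.L ^ h) (hyY : ∀ i, (y i).val / P.L ^ (h - j) = (Y i).val) (ν : Fin P.d) :
    (C ν).val ≤ ((embIter j y) ν).val ∧ ((embIter j y) ν).val < (C ν).val + P.L ^ h := by
  have hL : 0 < P.L ^ h := pow_pos P.L_pos h
  have hdiv : ((embIter j y) ν).val / P.L ^ h = (Y ν).val := by rw [val_embIter_div_pow hjh hh, hyY]
  rw [hC ν, ← hdiv]
  exact ⟨Nat.div_mul_le_self _ _, Nat.lt_div_mul_add hL⟩

/-! ## §4 Re-centring the profile's support box -/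

/-- `transl C w = transl c₀ (w + (C − c₀))` with the difference taken on labels. [cite: Balaban1987RG1, (0.1) p.251] -/
theorem transl_eq_transl_recentre {k : ℕ} (C c₀ : Site P k) (w : Zd P.d) :
    transl C w = transl c₀ (fun ν => w ν + (((C ν).val : ℤ) - ((c₀ ν).val : ℤ))) := by
  funext ν
  simp only [transl]
  push_cast
  rw [ZMod.natCast_zmod_val, ZMod.natCast_zmod_val]
  ring

/-- ★ **THE SUPPORT BOX RE-CENTRED**: if `val(C ν) ≤ val(c₀ ν) < val(C ν) + M` for every `ν`, then every `transl C w` with `w ∈ box 0 R` is `transl c₀ z` with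
`|z ν| ≤ R + M` — the `hS` hypothesis shape (`b.src = transl c₀ z`, `(z ν).natAbs ≤ r`) of the comb sweep pair and its action rows, `r := R + M`.
[cite: Balaban1987RG1, (0.1) p.251] -/
theorem exists_recentred {k : ℕ} (C c₀ : Site P k) {M R : ℕ} (hle : ∀ ν, (C ν).val ≤ (c₀ ν).val) (hlt : ∀ ν, (c₀ ν).val < (C ν).val + M)
    {w : Zd P.d} (hw : w ∈ box (0 : Zd P.d) (R : ℤ)) :
    ∃ z : Fin P.d → ℤ, (∀ ν, (z ν).natAbs ≤ R + M) ∧ transl C w = transl c₀ z := by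
  refine ⟨fun ν => w ν + (((C ν).val : ℤ) - ((c₀ ν).val : ℤ)), fun ν => ?_, transl_eq_transl_recentre C c₀ w⟩
  have hwν : |w ν| ≤ (R : ℤ) := by have := (mem_box.mp hw) ν; simpa using this
  have h1 : ((C ν).val : ℤ) ≤ ((c₀ ν).val : ℤ) := by exact_mod_cast hle ν
  have h2 : ((c₀ ν).val : ℤ) < ((C ν).val : ℤ) + M := by exact_mod_cast hlt ν
  have habs : |w ν + (((C ν).val : ℤ) - ((c₀ ν).val : ℤ))| ≤ (R : ℤ) + M := by
    refine (abs_add_le _ _).trans ?_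
    have : |((C ν).val : ℤ) - ((c₀ ν).val : ℤ)| ≤ M := by rw [abs_sub_comm, abs_of_nonneg (by linarith)]; linarith
    linarith
  show (w ν + (((C ν).val : ℤ) - ((c₀ ν).val : ℤ))).natAbs ≤ R + M
  have hcast : ((w ν + (((C ν).val : ℤ) - ((c₀ ν).val : ℤ))).natAbs : ℤ) ≤ ((R + M : ℕ) : ℤ) := by
    rw [Int.natCast_natAbs]; push_cast; exact habs
  exact_mod_cast hcast

end Summit.QuantumFields.YangMills.Theorems.CovariantDischargeDoorSites
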